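/-
Origin: expansion seat `prover-pub-hodgecm-mc-carch-1-g38-0`, handover #CA72 2026-08-21T03:38Z md5 fdd0dde6275d (382 l.; NEW additive leaf; imports #CA70 Model.ArchKTypeOfCentralWeightPin (this kit) + Model.ThetaAdelicSideR2 + Model.ThetaAdelicSideGuardedT2Ops; ns HodgeCM.Model.ArchSideTerm + HodgeCM.Model.SInstance; 19 theorems 0 defs; NAMES for audit: HodgeCM.Model.SInstance.w_ROGT'C_mul_lineCharV_one_eq_torusScalar · HodgeCM.Model.SInstance.lineCharV_one_center_mul_lineC_ROGT'C · HodgeCM.Model.ArchSideTerm.lineCharV_one_etaT₁) (`HOME/mc/pub-hodgecm-mc-carch-1/stage71/HodgeCM/Model/ArchKTypeOfCentralWeightR2.lean`, md5 fdd0dde6275d, 382 lines);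
landed by the gen-30 packager (p-g30) in gate run 71 as `HodgeCM/Model/ArchKTypeOfCentralWeightR2.lean` (verbatim).
-/
/-
Copyright (c) 2026. Released under Apache 2.0 license as described in the file LICENSE.
Cell pub-hodgecm, MODEL layer (construction prover mc-carch-1, gen 38), row-9 (J-Liu-Θ) junction: (CF_k) ∕ (Hw_k′) ∕ (CC_k) INSTANTIATED AT
THE PIN OF RECORD R2 `SInstance.SROGT'C` (lead ROUTING WORD (R2-PIN) 2026-08-21), slots 0 and 1 — binder-2's `hw` input of the slot-1 junction
binder `hJ` as a closed term over the pin's E-level inputs `hGR hGR₀ hGR₁ hGR₂ hGR₃ μ hΔ₁ hΔ₂ hΔ₃` and the OG guard.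
-/
import Summits.HodgeConjecture.HodgeCM.Model.ArchKTypeOfCentralWeightPin
import Summits.HodgeConjecture.HodgeCM.Model.ThetaAdelicSideR2
import Summits.HodgeConjecture.HodgeCM.Model.ThetaAdelicSideGuardedT2Ops_2

/-!
# `w_k · s_k(centre) = torusScalar_k` AT THE PIN OF RECORD R2 (slots 0, 1)

`Model/ArchKTypeOfCentralWeightPin` (#CA70) proves (CF_k) ∕ (Hw_k′) ∕ (CC_k), `k = 0, 1`, for the honest harmonic slot family
`Φ_∞,k(ℓ) := blockFamilyOfAt … eR eS (degOnePDual Empty) (binvPi 1) ℓ` from binder-1's pin block `hemb eR eS hχ a hω hdef` (#R125 ∕ #R129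
currency), for ANY four `η`'s and ANY archimedean input `A`.  This leaf PLUGS the pin of record:

* the side is `S := SInstance.SROGT'C @hGR @hGR₀ @hGR₁ @hGR₂ @hGR₃ @μ hΔ₁ hΔ₂ hΔ₃ V c` (`Model/ThetaAdelicSideR2`), which under the OG guard
  `hc : GOG V c` IS period-1's doubly twisted term `archSideOfT' … (ART' … V c hc)` (`SROGT'C_eq_archSideOfT'`), so its slot characters are
  `η₀ ∕ η₁ := etaT₀ ∕ etaT₁ V c.D (EtaChi.η χVR (χWR μ) V c) (νR V c)` and its archimedean inputs are `A k := ART' … V c hc k` with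
  `(ART' … k).Φinf = Φ_∞,k(⟨e₀, ·⟩)` at `eR := posIdxEquivUnit (hpos_GOG V c hc)…`, `eS := negIdxEquivEmpty (hpos_GOG V c hc)…` BY `rfl`
  (theta-3's `linePhi_def` through sinst-1's `archLineDatumOfReadOff_Φinf`) — § 1 `ART'_Φinf_zero/one`, `SROGT'C_P_Φinf_eq_linePhi_zero/one`;
* binder-1's pin block is DISCHARGED by the pin's own sockets: `h₁W := hG_GOG V c hc`, `hemb := hc.1`, `hχ := SInstance.hχ_zero/one_ROGTC … hc`
  (#1216 § 2 ← #CA34), `a := defExponentZero/One …`, `hω := defExponentZero/One_spec …` (#CA33), `hdef := SInstance.hdef_zero/one_ROGTC … hc`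
  (#1216 § 2 ← #CA33) — the SAME eight terms glue-1's R2 E-child `…OGISTR2D` plugs into row 12;
* whence, HYPOTHESIS-FREE UNDER THE GUARD (§ 2): **`lineCharV_zero/one_smul_cmArchCenter_linePhi_ROGT'C`** ((CF_k) on the pinned vector
  `linePhi`), **`w_ART'_mul_lineCharV_zero/one_eq_torusScalar`**, **`w_ROGT'C_mul_lineCharV_zero/one_eq_torusScalar`** ((Hw_k′) with the
  pin's literal weight `((SROGT'C … V c).P k).w t` — binder-2's `hw` of `hJ_slot_one_G_probe` at `S := SROGT'C … V c`,
  `χ₁ := etaT₁ V c.D (EtaChi.η χVR (χWR μ) V c) (νR V c)`), **`archWeight_mul_lineCharV_zero/one_eq_torusScalar_ROGT'C`** (the same with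
  the weight read back as `archWeight L (μ c k)`, #CA60 `SROGT'C_P_w_apply`), and **`lineCharV_zero/one_center_mul_lineC_ROGT'C`** ((CC_k):
  `s_k(u_t · 1_V) · lineC_k(t) = 1`, the bridge to theta-3's index-side `centralTypeOf` ∕ #S19 `centerCharInf`);
* § 0 records the `V`-characters of the twisted splits once: `lineCharV_one … (etaT₁ V S η ν) = ν` (the slot-1 dictionary twist IS `ν`),
  `lineCharV_zero … (etaT₀ V S η ν) v = (ν v)⁻¹ · η(v,1) · χ₀(v,1)`.

Slots 2, 3 (conjugated plane, `ν′ := ν'R`): the sibling `Model/ArchKTypeOfCentralWeightR234`.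
Nothing is cited and nothing is minted: kernel lemmas over installed carch ∕ sinst-1 ∕ theta-3 modules; 0 records, 0 defs, 0 `def … : Prop`.
-/

set_option autoImplicit false

noncomputable section

open NumberField NumberField.InfinitePlace NumberField.mixedEmbedding IsDedekindDomain
open scoped Matrix TensorProduct Classical SchwartzMap
open MulAction
open Literature.Geometry.ComplexHyperbolic.BallModel (U21 x₀ stabilizerEquivK21 blockK blockU)
open Literature.NumberTheory.Automorphic.U21 (K21 matA sclD)
open Literature.AlgebraicGeometry.ShimuraVarieties Literature.AlgebraicGeometry.ShimuraVarieties.BallForms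
open Literature.NumberTheory.Automorphic Literature.NumberTheory.Automorphic.UnitaryGroup Literature.NumberTheory.Weil1964
open Literature.RepresentationTheory.KonnoKonno2007 Literature.RepresentationTheory.KonnoKonno2007.RealDualPair
open Literature.NumberTheory.GelbartRogawski1991 Literature.NumberTheory.GelbartRogawski1991.UnitaryDualPair
open Literature.Analysis.SegalBargmann
open HodgeCM.Adelic HodgeCM.PerL34 HodgeCM.Model.HypCensus HodgeCM.Model.SupplyInstance

/-! ### § 0. The `V`-characters of the twisted splits (generic `η`, `ν`) -/

namespace HodgeCM.Model.ArchSideTerm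

section Split

variable {L : CMField} {ι₁ : L →+* ℂ} (V : HermSpace3 L ι₁) (S : StubTree.SeesawDatum L)
variable
  (hGR : (cmSplittingDatum (L : Type) finProdFinEquiv (frameD V) (frameD_real V) (frameD_ne V) (dW S) (dW_real S) (dW_ne S)).CompatibleSplitting)
  (hGR₀ : (cmSplittingDatum (L : Type) (e₁) (frameD V) (frameD_real V) (frameD_ne V) (lineVec (L : Type) (dW S 0))
    (fun _ => dW_real S 0) (fun _ => dW_ne S 0)).CompatibleSplitting)
  (hGR₁ : (cmSplittingDatum (L : Type) (e₁) (frameD V) (frameD_real V) (frameD_ne V) (lineVec (L : Type) (dW S 1))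
    (fun _ => dW_real S 1) (fun _ => dW_ne S 1)).CompatibleSplitting)
  (η : CMAdelic (L : Type) (frameD V) × CMAdelic (L : Type) (dW S) →* ℂˣ) (ν : CMAdelic (L : Type) (frameD V) →* ℂˣ)

/-- **the slot-1 `V`-character of the `ν`-twisted split IS `ν`**: `lineCharV_one … (etaT₁ V S η ν) = ν` (`etaT₁_apply_mk_one` — the twist
carries `ν` on `U(V) × 1` — and #CA21 `cmLineChar₁_apply_mk_one` — K-1's `χ₁ = λ₄ ∘ pr₂` has no `V`-part); at the pins of record `ν := νR V c`. -/
theorem lineCharV_one_etaT₁ : lineCharV_one V S hGR hGR₀ hGR₁ (etaT₁ V S η ν) = ν := by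
  refine MonoidHom.ext fun v => ?_
  rw [lineCharV_one_apply, etaT₁_apply_mk_one, cmLineChar₁_apply_mk_one, mul_one]

/-- pointwise form of `lineCharV_one_etaT₁`. -/
theorem lineCharV_one_etaT₁_apply (v : CMAdelic (L : Type) (frameD V)) : lineCharV_one V S hGR hGR₀ hGR₁ (etaT₁ V S η ν) v = ν v := by
  rw [lineCharV_one_etaT₁]

/-- the slot-0 `V`-character of the `ν`-twisted split: `lineCharV_zero … (etaT₀ V S η ν) v = ν(v)⁻¹ · η(v, 1) · χ₀(v, 1)` (`etaT₀_apply_mk_one`). -/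
theorem lineCharV_zero_etaT₀_apply (v : CMAdelic (L : Type) (frameD V)) :
    lineCharV_zero V S hGR hGR₀ hGR₁ (etaT₀ V S η ν) v =
      (ν v)⁻¹ * η (v, 1) *
        cmLineChar₀ (L : Type) finProdFinEquiv e₁ (frameD V) (frameD_real V) (frameD_ne V) (dW S) (dW_real S) (dW_ne S) hGR hGR₀ hGR₁ (v, 1) := by
  rw [lineCharV_zero_apply, etaT₀_apply_mk_one]

end Split

end HodgeCM.Model.ArchSideTerm

namespace HodgeCM.Model.SInstance

open HodgeCM.Model.ArchSideTerm

variable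
  (hGR : ∀ {L : CMField} {ι₁ : L →+* ℂ} (V : HermSpace3 L ι₁) (c : SeesawCtx L),
    (cmSplittingDatum (L : Type) finProdFinEquiv (frameD V) (frameD_real V) (frameD_ne V) (dW c.D) (dW_real c.D)
      (dW_ne c.D)).CompatibleSplitting)
  (hGR₀ : ∀ {L : CMField} {ι₁ : L →+* ℂ} (V : HermSpace3 L ι₁) (c : SeesawCtx L),
    (cmSplittingDatum (L : Type) (e₁) (frameD V) (frameD_real V) (frameD_ne V) (lineVec (L : Type) (dW c.D 0))
      (fun _ => dW_real c.D 0) (fun _ => dW_ne c.D 0)).CompatibleSplitting)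
  (hGR₁ : ∀ {L : CMField} {ι₁ : L →+* ℂ} (V : HermSpace3 L ι₁) (c : SeesawCtx L),
    (cmSplittingDatum (L : Type) (e₁) (frameD V) (frameD_real V) (frameD_ne V) (lineVec (L : Type) (dW c.D 1))
      (fun _ => dW_real c.D 1) (fun _ => dW_ne c.D 1)).CompatibleSplitting)
  (hGR₂ : ∀ {L : CMField} {ι₁ : L →+* ℂ} (V : HermSpace3 L ι₁) (c : SeesawCtx L),
    (cmSplittingDatum (L : Type) (e₁) (frameD V) (frameD_real V) (frameD_ne V) (lineVec (L : Type) (dW' c.D 0))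
      (fun _ => dW'_real c.D 0) (fun _ => dW'_ne c.D 0)).CompatibleSplitting)
  (hGR₃ : ∀ {L : CMField} {ι₁ : L →+* ℂ} (V : HermSpace3 L ι₁) (c : SeesawCtx L),
    (cmSplittingDatum (L : Type) (e₁) (frameD V) (frameD_real V) (frameD_ne V) (lineVec (L : Type) (dW' c.D 1))
      (fun _ => dW'_real c.D 1) (fun _ => dW'_ne c.D 1)).CompatibleSplitting)
  (μ : ∀ {L : CMField}, SeesawCtx L → Fin 4 → NumberField.InfinitePlace (L : Type) → ℤ)
  (hΔ₁ : ∀ {L : CMField} {ι₁ : L →+* ℂ} (V : HermSpace3 L ι₁) (c : SeesawCtx L), ∀ hc : GOG V c,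
    slotTypeVec V c (hGR V c) (hGR₀ V c) (hGR₁ V c) (hGR₂ V c) (hGR₃ V c) (hG_GOG V c hc) 1 -
      slotTypeVec V c (hGR V c) (hGR₀ V c) (hGR₁ V c) (hGR₂ V c) (hGR₃ V c) (hG_GOG V c hc) 0 = μ c 1 - μ c 0)
  (hΔ₂ : ∀ {L : CMField} {ι₁ : L →+* ℂ} (V : HermSpace3 L ι₁) (c : SeesawCtx L), ∀ hc : GOG V c,
    slotTypeVec V c (hGR V c) (hGR₀ V c) (hGR₁ V c) (hGR₂ V c) (hGR₃ V c) (hG_GOG V c hc) 2 -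
      slotTypeVec V c (hGR V c) (hGR₀ V c) (hGR₁ V c) (hGR₂ V c) (hGR₃ V c) (hG_GOG V c hc) 0 = μ c 2 - μ c 0)
  (hΔ₃ : ∀ {L : CMField} {ι₁ : L →+* ℂ} (V : HermSpace3 L ι₁) (c : SeesawCtx L), ∀ hc : GOG V c,
    slotTypeVec V c (hGR V c) (hGR₀ V c) (hGR₁ V c) (hGR₂ V c) (hGR₃ V c) (hG_GOG V c hc) 3 -
      slotTypeVec V c (hGR V c) (hGR₀ V c) (hGR₁ V c) (hGR₂ V c) (hGR₃ V c) (hG_GOG V c hc) 0 = μ c 3 - μ c 0)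

variable {L : CMField} {ι₁ : L →+* ℂ} (V : HermSpace3 L ι₁) (c : SeesawCtx L)

/-! ### § 1. The pinned archimedean vectors of slots 0, 1 ARE the harmonic slot families at `⟨e₀, ·⟩` (`rfl`) -/

/-- the archimedean test function of the pin's slot-0 input `ART' … 0` IS `Φ_∞,0(⟨e₀, ·⟩)` at `eR ∕ eS := posIdxEquivUnit ∕ negIdxEquivEmpty
(hpos_GOG V c hc).1` — theta-3's `linePhi_def` through `archLineInputT'_Φinf`, `archLineInputOf_Φinf`, `archLineDatumOfReadOff_Φinf` (all `rfl`). -/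
theorem ART'_Φinf_zero (hc : GOG V c) :
    (ART' @GOG @hG_GOG @hGR @(@χVR @hGR @hGR₀ @hGR₁) @(@νR @hGR₁) @(@ν'R @hGR₃) @hGR₀ @hGR₁ @hGR₂ @hGR₃ @μ @hpos_GOG @hΔ₁ @hΔ₂ @hΔ₃ V c hc
          0).Φinf =
      blockFamilyOfAt (L : Type) e₁ (frameD V) (frameD_real V) (frameD_ne V) (lineVec (L : Type) (dW c.D 0)) (fun _ => dW_real c.D 0)
        (fun _ => dW_ne c.D 0) ι₁ (blockPosEquiv V) (blockNegEquiv V) (posIdxEquivUnit (hpos_GOG V c hc).1) (negIdxEquivEmpty (hpos_GOG V c hc).1)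
        (degOnePDual Empty) (binvPi 1) (dotProductEquiv ℂ (Fin 2) (Pi.single 0 1)) :=
  rfl

/-- slot-1 twin of `ART'_Φinf_zero` (`(hpos_GOG V c hc).2.1`). -/
theorem ART'_Φinf_one (hc : GOG V c) :
    (ART' @GOG @hG_GOG @hGR @(@χVR @hGR @hGR₀ @hGR₁) @(@νR @hGR₁) @(@ν'R @hGR₃) @hGR₀ @hGR₁ @hGR₂ @hGR₃ @μ @hpos_GOG @hΔ₁ @hΔ₂ @hΔ₃ V c hc
          1).Φinf =
      blockFamilyOfAt (L : Type) e₁ (frameD V) (frameD_real V) (frameD_ne V) (lineVec (L : Type) (dW c.D 1)) (fun _ => dW_real c.D 1)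
        (fun _ => dW_ne c.D 1) ι₁ (blockPosEquiv V) (blockNegEquiv V) (posIdxEquivUnit (hpos_GOG V c hc).2.1)
        (negIdxEquivEmpty (hpos_GOG V c hc).2.1) (degOnePDual Empty) (binvPi 1) (dotProductEquiv ℂ (Fin 2) (Pi.single 0 1)) :=
  rfl

/-- under the OG guard the pinned archimedean vector of slot 0 of `SROGT'C` is theta-3's `linePhi V (dW c.D 0) …` (#CA60 `SROGT'C_P_Φinf`). -/
theorem SROGT'C_P_Φinf_eq_linePhi_zero (hc : GOG V c) :
    ((SROGT'C @hGR @hGR₀ @hGR₁ @hGR₂ @hGR₃ @μ hΔ₁ hΔ₂ hΔ₃ V c).P 0).Φinf = linePhi V (dW c.D 0) (dW_real c.D 0) (dW_ne c.D 0) (hpos_GOG V c hc).1 := by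
  rw [SROGT'C_P_Φinf @hGR @hGR₀ @hGR₁ @hGR₂ @hGR₃ @μ hΔ₁ hΔ₂ hΔ₃ V c hc 0]
  rfl

/-- under the OG guard the pinned archimedean vector of slot 1 of `SROGT'C` is theta-3's `linePhi V (dW c.D 1) …`. -/
theorem SROGT'C_P_Φinf_eq_linePhi_one (hc : GOG V c) :
    ((SROGT'C @hGR @hGR₀ @hGR₁ @hGR₂ @hGR₃ @μ hΔ₁ hΔ₂ hΔ₃ V c).P 1).Φinf = linePhi V (dW c.D 1) (dW_real c.D 1) (dW_ne c.D 1) (hpos_GOG V c hc).2.1 :=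
  by
  rw [SROGT'C_P_Φinf @hGR @hGR₀ @hGR₁ @hGR₂ @hGR₃ @μ hΔ₁ hΔ₂ hΔ₃ V c hc 1]
  rfl

/-! ### § 2. (CF₀), (Hw₀′), (CC₀) at the pin of record -/

/-- **(CF₀) AT THE PIN, hypothesis-free under the guard**: the archimedean centre `u_t · 1_V` in the `U(V)`-slot of the pin's twisted line-0
kernel FIXES the pinned vector: `lineCharV_0(u_t · 1_V) • ω_∞,0(t · 1₃, 1) (linePhi₀) = linePhi₀`. -/
theorem lineCharV_zero_smul_cmArchCenter_linePhi_ROGT'C (hc : GOG V c)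
    (t : ↥(Literature.NumberTheory.Automorphic.relNormOneInfUnits (↥(maximalRealSubfield L)) L)) :
    ((lineCharV_zero V c.D (hGR V c) (hGR₀ V c) (hGR₁ V c)
          (etaT₀ V c.D (EtaChi.η (@χVR @hGR @hGR₀ @hGR₁) (@χWR @hGR @hGR₀ @hGR₁ @μ) V c) (νR @hGR₁ V c))
          (CMCenter (L : Type) (frameD V) ((UnitaryGroup.cmAdelicOneEquivRelNormOne (L : Type)).symm
            (Literature.NumberTheory.Automorphic.relNormOneInfToIdeles (↥(maximalRealSubfield L)) L t))) : ℂˣ) : ℂ) •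
        cmArchWeilRep (L : Type) e₁ (frameD V) (frameD_real V) (frameD_ne V) (lineVec (L : Type) (dW c.D 0)) (fun _ => dW_real c.D 0)
          (fun _ => dW_ne c.D 0) (hGR₀ V c) (cmArchCenter (L : Type) 3 (Matrix.diagonal (frameD V)) t, 1)
          (linePhi V (dW c.D 0) (dW_real c.D 0) (dW_ne c.D 0) (hpos_GOG V c hc).1) =
      linePhi V (dW c.D 0) (dW_real c.D 0) (dW_ne c.D 0) (hpos_GOG V c hc).1 :=
  lineCharV_zero_smul_cmArchCenter_blockFamilyOfAt (V := V) (c := c) (hGR := hGR V c) (hGR₀ := hGR₀ V c) (hGR₁ := hGR₁ V c)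
    (η₀ := etaT₀ V c.D (EtaChi.η (@χVR @hGR @hGR₀ @hGR₁) (@χWR @hGR @hGR₀ @hGR₁ @μ) V c) (νR @hGR₁ V c))
    (h₁W := hG_GOG V c hc) (hemb := hc.1) (eR := posIdxEquivUnit (hpos_GOG V c hc).1) (eS := negIdxEquivEmpty (hpos_GOG V c hc).1)
    (hχ := hχ_zero_ROGTC @hGR @hGR₀ @hGR₁ @μ V c hc) (a := defExponentZero V c (hGR₀ V c) (hpos_GOG V c hc).1)
    (hω := defExponentZero_spec V c (hGR₀ V c) (hpos_GOG V c hc).1) (hdef := hdef_zero_ROGTC @hGR @hGR₀ @hGR₁ @μ V c hc) (t := t)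
    (ℓ := dotProductEquiv ℂ (Fin 2) (Pi.single 0 1))

/-- **(Hw₀′) for the pin's slot-0 archimedean input `ART' … 0`, hypothesis-free under the guard**:
`(ART' … 0).w t · lineCharV_0(u_t · 1_V) = torusScalar_0(u_t)` (#CA70 `w_mul_lineCharV_zero_eq_torusScalar_of_eq_blockFamilyOfAt` at the eight
pin sockets and `hΦ := ART'_Φinf_zero`). -/
theorem w_ART'_mul_lineCharV_zero_eq_torusScalar (hc : GOG V c)
    (t : ↥(Literature.NumberTheory.Automorphic.relNormOneInfUnits (↥(maximalRealSubfield L)) L)) :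
    (ART' @GOG @hG_GOG @hGR @(@χVR @hGR @hGR₀ @hGR₁) @(@νR @hGR₁) @(@ν'R @hGR₃) @hGR₀ @hGR₁ @hGR₂ @hGR₃ @μ @hpos_GOG @hΔ₁ @hΔ₂ @hΔ₃ V c hc
            0).w t *
        ((lineCharV_zero V c.D (hGR V c) (hGR₀ V c) (hGR₁ V c)
            (etaT₀ V c.D (EtaChi.η (@χVR @hGR @hGR₀ @hGR₁) (@χWR @hGR @hGR₀ @hGR₁ @μ) V c) (νR @hGR₁ V c))
            (CMCenter (L : Type) (frameD V) ((UnitaryGroup.cmAdelicOneEquivRelNormOne (L : Type)).symm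
              (Literature.NumberTheory.Automorphic.relNormOneInfToIdeles (↥(maximalRealSubfield L)) L t))) : ℂˣ) : ℂ) =
      ((torusScalar_zeroG V c.D (hGR V c) (hGR₀ V c) (hGR₁ V c)
          (etaT₀ V c.D (EtaChi.η (@χVR @hGR @hGR₀ @hGR₁) (@χWR @hGR @hGR₀ @hGR₁ @μ) V c) (νR @hGR₁ V c))
          ((UnitaryGroup.cmAdelicOneEquivRelNormOne (L : Type)).symm
            (Literature.NumberTheory.Automorphic.relNormOneInfToIdeles (↥(maximalRealSubfield L)) L t)) : ℂˣ) : ℂ) :=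
  w_mul_lineCharV_zero_eq_torusScalar_of_eq_blockFamilyOfAt (V := V) (c := c) (hGR := hGR V c) (hGR₀ := hGR₀ V c) (hGR₁ := hGR₁ V c)
    (η₀ := etaT₀ V c.D (EtaChi.η (@χVR @hGR @hGR₀ @hGR₁) (@χWR @hGR @hGR₀ @hGR₁ @μ) V c) (νR @hGR₁ V c))
    (η₁ := etaT₁ V c.D (EtaChi.η (@χVR @hGR @hGR₀ @hGR₁) (@χWR @hGR @hGR₀ @hGR₁ @μ) V c) (νR @hGR₁ V c))
    (h₁W := hG_GOG V c hc) (hemb := hc.1) (eR := posIdxEquivUnit (hpos_GOG V c hc).1) (eS := negIdxEquivEmpty (hpos_GOG V c hc).1)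
    (hχ := hχ_zero_ROGTC @hGR @hGR₀ @hGR₁ @μ V c hc) (a := defExponentZero V c (hGR₀ V c) (hpos_GOG V c hc).1)
    (hω := defExponentZero_spec V c (hGR₀ V c) (hpos_GOG V c hc).1) (hdef := hdef_zero_ROGTC @hGR @hGR₀ @hGR₁ @μ V c hc)
    (hGR₂ := hGR₂ V c) (hGR₃ := hGR₃ V c)
    (η₂ := etaT₂ V c.D (EtaChi.η (@χVR @hGR @hGR₀ @hGR₁) (@χWR @hGR @hGR₀ @hGR₁ @μ) V c) (ν'R @hGR₃ V c))
    (η₃ := etaT₃ V c.D (EtaChi.η (@χVR @hGR @hGR₀ @hGR₁) (@χWR @hGR @hGR₀ @hGR₁ @μ) V c) (ν'R @hGR₃ V c))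
    (A := ART' @GOG @hG_GOG @hGR @(@χVR @hGR @hGR₀ @hGR₁) @(@νR @hGR₁) @(@ν'R @hGR₃) @hGR₀ @hGR₁ @hGR₂ @hGR₃ @μ @hpos_GOG @hΔ₁ @hΔ₂ @hΔ₃
      V c hc 0)
    (hΦ := ART'_Φinf_zero @hGR @hGR₀ @hGR₁ @hGR₂ @hGR₃ @μ hΔ₁ hΔ₂ hΔ₃ V c hc) (t := t)

/-- **(Hw₀′) AT THE PIN OF RECORD, hypothesis-free under the guard** — binder-2 ∕ sinst-1's `hw` for slot 0 at `S := SROGT'C … V c`,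
`χ₀ := etaT₀ V c.D (EtaChi.η χVR (χWR μ) V c) (νR V c)`:  `((SROGT'C … V c).P 0).w t · lineCharV_0(u_t · 1_V) = torusScalar_0(u_t)`. -/
theorem w_ROGT'C_mul_lineCharV_zero_eq_torusScalar (hc : GOG V c)
    (t : ↥(Literature.NumberTheory.Automorphic.relNormOneInfUnits (↥(maximalRealSubfield L)) L)) :
    ((SROGT'C @hGR @hGR₀ @hGR₁ @hGR₂ @hGR₃ @μ hΔ₁ hΔ₂ hΔ₃ V c).P 0).w t *
        ((lineCharV_zero V c.D (hGR V c) (hGR₀ V c) (hGR₁ V c)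
            (etaT₀ V c.D (EtaChi.η (@χVR @hGR @hGR₀ @hGR₁) (@χWR @hGR @hGR₀ @hGR₁ @μ) V c) (νR @hGR₁ V c))
            (CMCenter (L : Type) (frameD V) ((UnitaryGroup.cmAdelicOneEquivRelNormOne (L : Type)).symm
              (Literature.NumberTheory.Automorphic.relNormOneInfToIdeles (↥(maximalRealSubfield L)) L t))) : ℂˣ) : ℂ) =
      ((torusScalar_zeroG V c.D (hGR V c) (hGR₀ V c) (hGR₁ V c)
          (etaT₀ V c.D (EtaChi.η (@χVR @hGR @hGR₀ @hGR₁) (@χWR @hGR @hGR₀ @hGR₁ @μ) V c) (νR @hGR₁ V c))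
          ((UnitaryGroup.cmAdelicOneEquivRelNormOne (L : Type)).symm
            (Literature.NumberTheory.Automorphic.relNormOneInfToIdeles (↥(maximalRealSubfield L)) L t)) : ℂˣ) : ℂ) := by
  rw [SROGT'C_eq_archSideOfT' @hGR @hGR₀ @hGR₁ @hGR₂ @hGR₃ @μ hΔ₁ hΔ₂ hΔ₃ V c hc, archSideOfT'_P_w]
  exact w_ART'_mul_lineCharV_zero_eq_torusScalar @hGR @hGR₀ @hGR₁ @hGR₂ @hGR₃ @μ hΔ₁ hΔ₂ hΔ₃ V c hc t

include hGR₂ hGR₃ hΔ₁ hΔ₂ hΔ₃ in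
/-- **(Hw₀′) AT THE PIN OF RECORD with the weight read back**: `archWeight L (μ c 0) t · lineCharV_0(u_t · 1_V) = torusScalar_0(u_t)`
(#CA60 `SROGT'C_P_w_apply`: every line weight of the pin is `archWeight L (μ c k)`). -/
theorem archWeight_mul_lineCharV_zero_eq_torusScalar_ROGT'C (hc : GOG V c)
    (t : ↥(Literature.NumberTheory.Automorphic.relNormOneInfUnits (↥(maximalRealSubfield L)) L)) :
    Literature.NumberTheory.Automorphic.archWeight (L : Type) (μ c 0) t *
        ((lineCharV_zero V c.D (hGR V c) (hGR₀ V c) (hGR₁ V c)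
            (etaT₀ V c.D (EtaChi.η (@χVR @hGR @hGR₀ @hGR₁) (@χWR @hGR @hGR₀ @hGR₁ @μ) V c) (νR @hGR₁ V c))
            (CMCenter (L : Type) (frameD V) ((UnitaryGroup.cmAdelicOneEquivRelNormOne (L : Type)).symm
              (Literature.NumberTheory.Automorphic.relNormOneInfToIdeles (↥(maximalRealSubfield L)) L t))) : ℂˣ) : ℂ) =
      ((torusScalar_zeroG V c.D (hGR V c) (hGR₀ V c) (hGR₁ V c)
          (etaT₀ V c.D (EtaChi.η (@χVR @hGR @hGR₀ @hGR₁) (@χWR @hGR @hGR₀ @hGR₁ @μ) V c) (νR @hGR₁ V c))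
          ((UnitaryGroup.cmAdelicOneEquivRelNormOne (L : Type)).symm
            (Literature.NumberTheory.Automorphic.relNormOneInfToIdeles (↥(maximalRealSubfield L)) L t)) : ℂˣ) : ℂ) := by
  rw [← SROGT'C_P_w_apply @hGR @hGR₀ @hGR₁ @hGR₂ @hGR₃ @μ hΔ₁ hΔ₂ hΔ₃ V c hc 0 t]
  exact w_ROGT'C_mul_lineCharV_zero_eq_torusScalar @hGR @hGR₀ @hGR₁ @hGR₂ @hGR₃ @μ hΔ₁ hΔ₂ hΔ₃ V c hc t

/-- **(CC₀) AT THE PIN OF RECORD, hypothesis-free under the guard**: `lineCharV_0(u_t · 1_V) · lineC₀(t) = 1` — on the archimedean centre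
the `V`-twist of the pin's slot-0 dictionary record is the INVERSE of theta-3's centre eigenvalue `lineC V (dW c.D 0) … (hGR₀ V c)` of the
untwisted `ω_∞,0` on the pinned vector (the sentence behind both #S19's index-side `hμ` and the automorphy-side `hw`). -/
theorem lineCharV_zero_center_mul_lineC_ROGT'C (hc : GOG V c)
    (t : ↥(Literature.NumberTheory.Automorphic.relNormOneInfUnits (↥(maximalRealSubfield L)) L)) :
    ((lineCharV_zero V c.D (hGR V c) (hGR₀ V c) (hGR₁ V c)
          (etaT₀ V c.D (EtaChi.η (@χVR @hGR @hGR₀ @hGR₁) (@χWR @hGR @hGR₀ @hGR₁ @μ) V c) (νR @hGR₁ V c))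
          (CMCenter (L : Type) (frameD V) ((UnitaryGroup.cmAdelicOneEquivRelNormOne (L : Type)).symm
            (Literature.NumberTheory.Automorphic.relNormOneInfToIdeles (↥(maximalRealSubfield L)) L t))) : ℂˣ) : ℂ) *
        lineC V (dW c.D 0) (dW_real c.D 0) (dW_ne c.D 0) (hGR₀ V c) t = 1 :=
  lineCharV_zero_center_mul_lineC (V := V) (c := c) (hGR := hGR V c) (hGR₀ := hGR₀ V c) (hGR₁ := hGR₁ V c)
    (η₀ := etaT₀ V c.D (EtaChi.η (@χVR @hGR @hGR₀ @hGR₁) (@χWR @hGR @hGR₀ @hGR₁ @μ) V c) (νR @hGR₁ V c))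
    (h₁W := hG_GOG V c hc) (hemb := hc.1) (eR := posIdxEquivUnit (hpos_GOG V c hc).1) (eS := negIdxEquivEmpty (hpos_GOG V c hc).1)
    (hχ := hχ_zero_ROGTC @hGR @hGR₀ @hGR₁ @μ V c hc) (a := defExponentZero V c (hGR₀ V c) (hpos_GOG V c hc).1)
    (hω := defExponentZero_spec V c (hGR₀ V c) (hpos_GOG V c hc).1) (hdef := hdef_zero_ROGTC @hGR @hGR₀ @hGR₁ @μ V c hc) (t := t)

/-! ### § 3. (CF₁), (Hw₁′), (CC₁) at the pin of record — the slot-1 junction binder's `hw` -/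

/-- **(CF₁) AT THE PIN, hypothesis-free under the guard**: `lineCharV_1(u_t · 1_V) • ω_∞,1(t · 1₃, 1) (linePhi₁) = linePhi₁`. -/
theorem lineCharV_one_smul_cmArchCenter_linePhi_ROGT'C (hc : GOG V c)
    (t : ↥(Literature.NumberTheory.Automorphic.relNormOneInfUnits (↥(maximalRealSubfield L)) L)) :
    ((lineCharV_one V c.D (hGR V c) (hGR₀ V c) (hGR₁ V c)
          (etaT₁ V c.D (EtaChi.η (@χVR @hGR @hGR₀ @hGR₁) (@χWR @hGR @hGR₀ @hGR₁ @μ) V c) (νR @hGR₁ V c))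
          (CMCenter (L : Type) (frameD V) ((UnitaryGroup.cmAdelicOneEquivRelNormOne (L : Type)).symm
            (Literature.NumberTheory.Automorphic.relNormOneInfToIdeles (↥(maximalRealSubfield L)) L t))) : ℂˣ) : ℂ) •
        cmArchWeilRep (L : Type) e₁ (frameD V) (frameD_real V) (frameD_ne V) (lineVec (L : Type) (dW c.D 1)) (fun _ => dW_real c.D 1)
          (fun _ => dW_ne c.D 1) (hGR₁ V c) (cmArchCenter (L : Type) 3 (Matrix.diagonal (frameD V)) t, 1)
          (linePhi V (dW c.D 1) (dW_real c.D 1) (dW_ne c.D 1) (hpos_GOG V c hc).2.1) =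
      linePhi V (dW c.D 1) (dW_real c.D 1) (dW_ne c.D 1) (hpos_GOG V c hc).2.1 :=
  lineCharV_one_smul_cmArchCenter_blockFamilyOfAt (V := V) (c := c) (hGR := hGR V c) (hGR₀ := hGR₀ V c) (hGR₁ := hGR₁ V c)
    (η₁ := etaT₁ V c.D (EtaChi.η (@χVR @hGR @hGR₀ @hGR₁) (@χWR @hGR @hGR₀ @hGR₁ @μ) V c) (νR @hGR₁ V c))
    (h₁W := hG_GOG V c hc) (hemb := hc.1) (eR := posIdxEquivUnit (hpos_GOG V c hc).2.1) (eS := negIdxEquivEmpty (hpos_GOG V c hc).2.1)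
    (hχ := hχ_one_ROGTC @hGR @hGR₀ @hGR₁ @μ V c hc) (a := defExponentOne V c (hGR₁ V c) (hpos_GOG V c hc).2.1)
    (hω := defExponentOne_spec V c (hGR₁ V c) (hpos_GOG V c hc).2.1) (hdef := hdef_one_ROGTC @hGR @hGR₀ @hGR₁ @μ V c hc) (t := t)
    (ℓ := dotProductEquiv ℂ (Fin 2) (Pi.single 0 1))

/-- **(Hw₁′) for the pin's slot-1 archimedean input `ART' … 1`, hypothesis-free under the guard**:
`(ART' … 1).w t · lineCharV_1(u_t · 1_V) = torusScalar_1(u_t)` (here `lineCharV_1 = νR V c`, `lineCharV_one_etaT₁`). -/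
theorem w_ART'_mul_lineCharV_one_eq_torusScalar (hc : GOG V c)
    (t : ↥(Literature.NumberTheory.Automorphic.relNormOneInfUnits (↥(maximalRealSubfield L)) L)) :
    (ART' @GOG @hG_GOG @hGR @(@χVR @hGR @hGR₀ @hGR₁) @(@νR @hGR₁) @(@ν'R @hGR₃) @hGR₀ @hGR₁ @hGR₂ @hGR₃ @μ @hpos_GOG @hΔ₁ @hΔ₂ @hΔ₃ V c hc
            1).w t *
        ((lineCharV_one V c.D (hGR V c) (hGR₀ V c) (hGR₁ V c)
            (etaT₁ V c.D (EtaChi.η (@χVR @hGR @hGR₀ @hGR₁) (@χWR @hGR @hGR₀ @hGR₁ @μ) V c) (νR @hGR₁ V c))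
            (CMCenter (L : Type) (frameD V) ((UnitaryGroup.cmAdelicOneEquivRelNormOne (L : Type)).symm
              (Literature.NumberTheory.Automorphic.relNormOneInfToIdeles (↥(maximalRealSubfield L)) L t))) : ℂˣ) : ℂ) =
      ((torusScalar_oneG V c.D (hGR V c) (hGR₀ V c) (hGR₁ V c)
          (etaT₁ V c.D (EtaChi.η (@χVR @hGR @hGR₀ @hGR₁) (@χWR @hGR @hGR₀ @hGR₁ @μ) V c) (νR @hGR₁ V c))
          ((UnitaryGroup.cmAdelicOneEquivRelNormOne (L : Type)).symm
            (Literature.NumberTheory.Automorphic.relNormOneInfToIdeles (↥(maximalRealSubfield L)) L t)) : ℂˣ) : ℂ) :=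
  w_mul_lineCharV_one_eq_torusScalar_of_eq_blockFamilyOfAt (V := V) (c := c) (hGR := hGR V c) (hGR₀ := hGR₀ V c) (hGR₁ := hGR₁ V c)
    (η₀ := etaT₀ V c.D (EtaChi.η (@χVR @hGR @hGR₀ @hGR₁) (@χWR @hGR @hGR₀ @hGR₁ @μ) V c) (νR @hGR₁ V c))
    (η₁ := etaT₁ V c.D (EtaChi.η (@χVR @hGR @hGR₀ @hGR₁) (@χWR @hGR @hGR₀ @hGR₁ @μ) V c) (νR @hGR₁ V c))
    (h₁W := hG_GOG V c hc) (hemb := hc.1) (eR := posIdxEquivUnit (hpos_GOG V c hc).2.1) (eS := negIdxEquivEmpty (hpos_GOG V c hc).2.1)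
    (hχ := hχ_one_ROGTC @hGR @hGR₀ @hGR₁ @μ V c hc) (a := defExponentOne V c (hGR₁ V c) (hpos_GOG V c hc).2.1)
    (hω := defExponentOne_spec V c (hGR₁ V c) (hpos_GOG V c hc).2.1) (hdef := hdef_one_ROGTC @hGR @hGR₀ @hGR₁ @μ V c hc)
    (hGR₂ := hGR₂ V c) (hGR₃ := hGR₃ V c)
    (η₂ := etaT₂ V c.D (EtaChi.η (@χVR @hGR @hGR₀ @hGR₁) (@χWR @hGR @hGR₀ @hGR₁ @μ) V c) (ν'R @hGR₃ V c))
    (η₃ := etaT₃ V c.D (EtaChi.η (@χVR @hGR @hGR₀ @hGR₁) (@χWR @hGR @hGR₀ @hGR₁ @μ) V c) (ν'R @hGR₃ V c))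
    (A := ART' @GOG @hG_GOG @hGR @(@χVR @hGR @hGR₀ @hGR₁) @(@νR @hGR₁) @(@ν'R @hGR₃) @hGR₀ @hGR₁ @hGR₂ @hGR₃ @μ @hpos_GOG @hΔ₁ @hΔ₂ @hΔ₃
      V c hc 1)
    (hΦ := ART'_Φinf_one @hGR @hGR₀ @hGR₁ @hGR₂ @hGR₃ @μ hΔ₁ hΔ₂ hΔ₃ V c hc) (t := t)

/-- **(Hw₁′) AT THE PIN OF RECORD, hypothesis-free under the guard** — THE `hw` INPUT of binder-2's slot-1 junction binder
(`hJ_slot_one_G_probe`) at `S := SROGT'C … V c`, `χ₁ := etaT₁ V c.D (EtaChi.η χVR (χWR μ) V c) (νR V c)` (sinst-1's `adelicCharOne … χ₁` is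
`lineCharV_one … χ₁`, same term):  `((SROGT'C … V c).P 1).w t · lineCharV_1(u_t · 1_V) = torusScalar_oneG … χ₁ (u_t)`. -/
theorem w_ROGT'C_mul_lineCharV_one_eq_torusScalar (hc : GOG V c)
    (t : ↥(Literature.NumberTheory.Automorphic.relNormOneInfUnits (↥(maximalRealSubfield L)) L)) :
    ((SROGT'C @hGR @hGR₀ @hGR₁ @hGR₂ @hGR₃ @μ hΔ₁ hΔ₂ hΔ₃ V c).P 1).w t *
        ((lineCharV_one V c.D (hGR V c) (hGR₀ V c) (hGR₁ V c)
            (etaT₁ V c.D (EtaChi.η (@χVR @hGR @hGR₀ @hGR₁) (@χWR @hGR @hGR₀ @hGR₁ @μ) V c) (νR @hGR₁ V c))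
            (CMCenter (L : Type) (frameD V) ((UnitaryGroup.cmAdelicOneEquivRelNormOne (L : Type)).symm
              (Literature.NumberTheory.Automorphic.relNormOneInfToIdeles (↥(maximalRealSubfield L)) L t))) : ℂˣ) : ℂ) =
      ((torusScalar_oneG V c.D (hGR V c) (hGR₀ V c) (hGR₁ V c)
          (etaT₁ V c.D (EtaChi.η (@χVR @hGR @hGR₀ @hGR₁) (@χWR @hGR @hGR₀ @hGR₁ @μ) V c) (νR @hGR₁ V c))
          ((UnitaryGroup.cmAdelicOneEquivRelNormOne (L : Type)).symm
            (Literature.NumberTheory.Automorphic.relNormOneInfToIdeles (↥(maximalRealSubfield L)) L t)) : ℂˣ) : ℂ) := by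
  rw [SROGT'C_eq_archSideOfT' @hGR @hGR₀ @hGR₁ @hGR₂ @hGR₃ @μ hΔ₁ hΔ₂ hΔ₃ V c hc, archSideOfT'_P_w]
  exact w_ART'_mul_lineCharV_one_eq_torusScalar @hGR @hGR₀ @hGR₁ @hGR₂ @hGR₃ @μ hΔ₁ hΔ₂ hΔ₃ V c hc t

include hGR₂ hGR₃ hΔ₁ hΔ₂ hΔ₃ in
/-- **(Hw₁′) AT THE PIN OF RECORD with the weight read back**: `archWeight L (μ c 1) t · lineCharV_1(u_t · 1_V) = torusScalar_1(u_t)`. -/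
theorem archWeight_mul_lineCharV_one_eq_torusScalar_ROGT'C (hc : GOG V c)
    (t : ↥(Literature.NumberTheory.Automorphic.relNormOneInfUnits (↥(maximalRealSubfield L)) L)) :
    Literature.NumberTheory.Automorphic.archWeight (L : Type) (μ c 1) t *
        ((lineCharV_one V c.D (hGR V c) (hGR₀ V c) (hGR₁ V c)
            (etaT₁ V c.D (EtaChi.η (@χVR @hGR @hGR₀ @hGR₁) (@χWR @hGR @hGR₀ @hGR₁ @μ) V c) (νR @hGR₁ V c))
            (CMCenter (L : Type) (frameD V) ((UnitaryGroup.cmAdelicOneEquivRelNormOne (L : Type)).symm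
              (Literature.NumberTheory.Automorphic.relNormOneInfToIdeles (↥(maximalRealSubfield L)) L t))) : ℂˣ) : ℂ) =
      ((torusScalar_oneG V c.D (hGR V c) (hGR₀ V c) (hGR₁ V c)
          (etaT₁ V c.D (EtaChi.η (@χVR @hGR @hGR₀ @hGR₁) (@χWR @hGR @hGR₀ @hGR₁ @μ) V c) (νR @hGR₁ V c))
          ((UnitaryGroup.cmAdelicOneEquivRelNormOne (L : Type)).symm
            (Literature.NumberTheory.Automorphic.relNormOneInfToIdeles (↥(maximalRealSubfield L)) L t)) : ℂˣ) : ℂ) := by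
  rw [← SROGT'C_P_w_apply @hGR @hGR₀ @hGR₁ @hGR₂ @hGR₃ @μ hΔ₁ hΔ₂ hΔ₃ V c hc 1 t]
  exact w_ROGT'C_mul_lineCharV_one_eq_torusScalar @hGR @hGR₀ @hGR₁ @hGR₂ @hGR₃ @μ hΔ₁ hΔ₂ hΔ₃ V c hc t

/-- **(Hw₁′) AT THE PIN OF RECORD in `ν`-form**: since `lineCharV_one … (etaT₁ …) = νR V c`, the slot-1 identity reads
`((SROGT'C … V c).P 1).w t · νR(u_t · 1_V) = torusScalar_oneG … (etaT₁ …) (u_t)` — the slot-1 dictionary record is the `νR`-twisted one. -/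
theorem w_ROGT'C_mul_νR_eq_torusScalar (hc : GOG V c)
    (t : ↥(Literature.NumberTheory.Automorphic.relNormOneInfUnits (↥(maximalRealSubfield L)) L)) :
    ((SROGT'C @hGR @hGR₀ @hGR₁ @hGR₂ @hGR₃ @μ hΔ₁ hΔ₂ hΔ₃ V c).P 1).w t *
        ((νR @hGR₁ V c
            (CMCenter (L : Type) (frameD V) ((UnitaryGroup.cmAdelicOneEquivRelNormOne (L : Type)).symm
              (Literature.NumberTheory.Automorphic.relNormOneInfToIdeles (↥(maximalRealSubfield L)) L t))) : ℂˣ) : ℂ) =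
      ((torusScalar_oneG V c.D (hGR V c) (hGR₀ V c) (hGR₁ V c)
          (etaT₁ V c.D (EtaChi.η (@χVR @hGR @hGR₀ @hGR₁) (@χWR @hGR @hGR₀ @hGR₁ @μ) V c) (νR @hGR₁ V c))
          ((UnitaryGroup.cmAdelicOneEquivRelNormOne (L : Type)).symm
            (Literature.NumberTheory.Automorphic.relNormOneInfToIdeles (↥(maximalRealSubfield L)) L t)) : ℂˣ) : ℂ) := by
  rw [← lineCharV_one_etaT₁_apply V c.D (hGR V c) (hGR₀ V c) (hGR₁ V c)
    (EtaChi.η (@χVR @hGR @hGR₀ @hGR₁) (@χWR @hGR @hGR₀ @hGR₁ @μ) V c) (νR @hGR₁ V c)]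
  exact w_ROGT'C_mul_lineCharV_one_eq_torusScalar @hGR @hGR₀ @hGR₁ @hGR₂ @hGR₃ @μ hΔ₁ hΔ₂ hΔ₃ V c hc t

/-- **(CC₁) AT THE PIN OF RECORD, hypothesis-free under the guard**: `lineCharV_1(u_t · 1_V) · lineC₁(t) = 1`, i.e.
`νR(u_t · 1_V) · lineC V (dW c.D 1) … (hGR₁ V c) t = 1` — the slot-1 twist `νR` on the archimedean centre is the INVERSE of theta-3's centre
eigenvalue of the untwisted `ω_∞,1` on the pinned vector. -/
theorem lineCharV_one_center_mul_lineC_ROGT'C (hc : GOG V c)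
    (t : ↥(Literature.NumberTheory.Automorphic.relNormOneInfUnits (↥(maximalRealSubfield L)) L)) :
    ((lineCharV_one V c.D (hGR V c) (hGR₀ V c) (hGR₁ V c)
          (etaT₁ V c.D (EtaChi.η (@χVR @hGR @hGR₀ @hGR₁) (@χWR @hGR @hGR₀ @hGR₁ @μ) V c) (νR @hGR₁ V c))
          (CMCenter (L : Type) (frameD V) ((UnitaryGroup.cmAdelicOneEquivRelNormOne (L : Type)).symm
            (Literature.NumberTheory.Automorphic.relNormOneInfToIdeles (↥(maximalRealSubfield L)) L t))) : ℂˣ) : ℂ) *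
        lineC V (dW c.D 1) (dW_real c.D 1) (dW_ne c.D 1) (hGR₁ V c) t = 1 :=
  lineCharV_one_center_mul_lineC (V := V) (c := c) (hGR := hGR V c) (hGR₀ := hGR₀ V c) (hGR₁ := hGR₁ V c)
    (η₁ := etaT₁ V c.D (EtaChi.η (@χVR @hGR @hGR₀ @hGR₁) (@χWR @hGR @hGR₀ @hGR₁ @μ) V c) (νR @hGR₁ V c))
    (h₁W := hG_GOG V c hc) (hemb := hc.1) (eR := posIdxEquivUnit (hpos_GOG V c hc).2.1) (eS := negIdxEquivEmpty (hpos_GOG V c hc).2.1)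
    (hχ := hχ_one_ROGTC @hGR @hGR₀ @hGR₁ @μ V c hc) (a := defExponentOne V c (hGR₁ V c) (hpos_GOG V c hc).2.1)
    (hω := defExponentOne_spec V c (hGR₁ V c) (hpos_GOG V c hc).2.1) (hdef := hdef_one_ROGTC @hGR @hGR₀ @hGR₁ @μ V c hc) (t := t)

include hGR hGR₀ μ in
/-- **(CC₁) AT THE PIN in `ν`-form**: `νR(u_t · 1_V) · lineC₁(t) = 1`. -/
theorem νR_center_mul_lineC_ROGT'C (hc : GOG V c)
    (t : ↥(Literature.NumberTheory.Automorphic.relNormOneInfUnits (↥(maximalRealSubfield L)) L)) :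
    ((νR @hGR₁ V c
          (CMCenter (L : Type) (frameD V) ((UnitaryGroup.cmAdelicOneEquivRelNormOne (L : Type)).symm
            (Literature.NumberTheory.Automorphic.relNormOneInfToIdeles (↥(maximalRealSubfield L)) L t))) : ℂˣ) : ℂ) *
        lineC V (dW c.D 1) (dW_real c.D 1) (dW_ne c.D 1) (hGR₁ V c) t = 1 := by
  rw [← lineCharV_one_etaT₁_apply V c.D (hGR V c) (hGR₀ V c) (hGR₁ V c)
    (EtaChi.η (@χVR @hGR @hGR₀ @hGR₁) (@χWR @hGR @hGR₀ @hGR₁ @μ) V c) (νR @hGR₁ V c)]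
  exact lineCharV_one_center_mul_lineC_ROGT'C @hGR @hGR₀ @hGR₁ @μ V c hc t

end HodgeCM.Model.SInstance

end
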